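import Summits.NavierStokesRegularity.NavierStokesRegularity.Theorems.QuantisedSymmetryPolyhedralDssProfileExistsOfCell
import Summits.NavierStokesRegularity.NavierStokesRegularity.Theorems.QuantisedSymmetryPolyhedralDssProfileExistsDominatesBlowupProfile
import HarnessLib

/-!
# Strategist sketch s17-g3 (family `s`, SECOND INDEPENDENT STRATEGY CENSUS) — crux
  `QuantisedSymmetry.PolyhedralDssProfileExists` (stmt-NavierStokesRegularity-1404)

Typed companions of `Cruxes/PolyhedralDssProfileExists/STRATEGY-CENSUS-s17.md`: every statement named in
the census is a `def … : Prop` here (no `sorry`), and every implication the census calls "trivial" or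
"a theorem of analysis" is proved here, so that the census's claims about WHICH piece carries the
difficulty are kernel-checked.  Nothing here is a route item; nothing here restates or weakens the crux.

Sections: §0 the cell form of the crux (by name, via the landed `stub_profileOfPolyhedralCell`);
§1 weaker intermediates (W₁ Type-I ancient existence; W₂ = `Blowup.BlowupTypeIDssProfile`);
§2 decompositions (D-CAP: certificate ∧ fixed-point theorem; D-A: approximate cells ∧ compactness);
§3 strengthenings (S⁺: the steady = continuously-self-similar polyhedral profile, refuted by Tsai 1998).
-/

noncomputable section

set_option linter.dupNamespace false

namespace Summit.NavierStokesRegularity.NavierStokesRegularity.Cruxes.PolyhedralDssProfileExists.StrategistS17g3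

open MeasureTheory Set Function Filter Topology
open scoped ENNReal NNReal
open Literature.Analysis.FluidPDE
open _root_.Summit.NavierStokesRegularity.NavierStokesRegularity.Theses

local notation "ℝ³" => EuclideanSpace ℝ (Fin 3)

/-! ## §0 The cell form of the crux -/

/-- A *polyhedral* group: a finite, orientation-preserving, irreducibly acting subgroup of the linear
isometries of `ℝ³` (the three group clauses of the crux). -/
def IsPolyhedralGroup (G : Subgroup (ℝ³ ≃ₗᵢ[ℝ] ℝ³)) : Prop :=
  Finite G ∧ (∀ g ∈ G, LinearMap.det (g.toLinearEquiv : ℝ³ →ₗ[ℝ] ℝ³) = 1) ∧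
    (∀ V : Submodule ℝ ℝ³, (∀ g ∈ G, ∀ v ∈ V, g v ∈ V) → V = ⊥ ∨ V = ⊤)

/-- A `G`-cell with factor `c` on the model period `[-1, -c⁻²]`: jointly continuous, bounded, weakly
divergence free, Oseen-mild between all pairs of model times, closing up under the zoom
`v(-c⁻², x) = c v(-1, c x)`, `G`-equivariant slice by slice (verbatim the hypothesis of the landed
`Theorems.PolyhedralDssProfileExists.PolyhedralCell.stub_profileOfPolyhedralCell`). -/
def IsGCell (G : Subgroup (ℝ³ ≃ₗᵢ[ℝ] ℝ³)) (c : ℝ) (v : ℝ → ℝ³ → ℝ³) : Prop :=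
  ContinuousOn (Function.uncurry v) (Set.Icc (-1 : ℝ) (-(c ^ 2)⁻¹) ×ˢ Set.univ) ∧
    (∃ M : ℝ, ∀ t ∈ Set.Icc (-1 : ℝ) (-(c ^ 2)⁻¹), ∀ x, ‖v t x‖ ≤ M) ∧
    (∀ t ∈ Set.Icc (-1 : ℝ) (-(c ^ 2)⁻¹), IsWeaklyDivFree (v t)) ∧
    (∀ s t : ℝ, -1 ≤ s → s < t → t ≤ -(c ^ 2)⁻¹ → ∀ x,
      v t x = heatFlow (v s) (t - s) x - oseenDuhamel 1 s v v t x) ∧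
    (∀ x, v (-(c ^ 2)⁻¹) x = c • v (-1) (c • x)) ∧
    (∀ g ∈ G, ∀ t ∈ Set.Icc (-1 : ℝ) (-(c ^ 2)⁻¹), ∀ x, v t (g x) = g (v t x))

/-- The cell form of the crux (`= stub_polyhedralCellExists` of line `polyhedral_cell`): a polyhedral group,
a factor `c > 1` and a `G`-cell whose datum is in `L⁴` and not a.e. zero. -/
def CellExists : Prop :=
  ∃ G : Subgroup (ℝ³ ≃ₗᵢ[ℝ] ℝ³), IsPolyhedralGroup G ∧ ∃ c : ℝ, 1 < c ∧ ∃ v : ℝ → ℝ³ → ℝ³,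
    IsGCell G c v ∧ MemLp (v (-1)) 4 volume ∧ ¬ (v (-1) =ᵐ[volume] 0)

/-- `CellExists → crux`, by the landed reduction `stub_profileOfPolyhedralCell` (p152884). -/
theorem crux_of_cellExists (h : CellExists) : QuantisedSymmetry.PolyhedralDssProfileExists := by
  obtain ⟨G, ⟨hfin, hdet, hirr⟩, c, hc, v, hcell, hL4, hnt⟩ := h
  exact Theorems.PolyhedralDssProfileExists.PolyhedralCell.stub_profileOfPolyhedralCell
    ⟨G, hfin, hdet, hirr, c, hc, v, hcell, hL4, hnt⟩

/-! ## §1 Weaker intermediates -/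

/-- **W₁** (the weakest existence statement below the crux that the census considers): a nontrivial
ancient mild solution with measurable slices and a Type-I space–time bound — no self-similarity, no
symmetry.  The negation of the weak-`L³,∞`/Type-I ancient Liouville statement (KNSS 2009 conjecture for
`|u| ≤ C/(|x|+√-t)`; cf. route item TypeILiouville stmt-0057). -/
def TypeIAncientExists : Prop :=
  ∃ u : ℝ → ℝ³ → ℝ³, IsAncientMildSolution 1 u ∧ (∀ t < 0, AEStronglyMeasurable (u t) volume) ∧
    (∃ C₀ : ℝ, HasTypeIDecay C₀ u) ∧ ¬ (∀ t < 0, u t =ᵐ[volume] 0)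

/-- crux → W₁ (projection). -/
theorem typeIAncientExists_of_crux (h : QuantisedSymmetry.PolyhedralDssProfileExists) :
    TypeIAncientExists := by
  obtain ⟨G, -, -, -, c, -, u, hanc, hmeas, -, hdec, -, hnt⟩ := h
  exact ⟨u, hanc, hmeas, hdec, hnt⟩

/-- **W₂** = `Blowup.BlowupTypeIDssProfile` (stmt-0155, the sector-free Type-I (R)DSS profile): crux → W₂ is
the landed `stub_dominatesBlowupProfile` (p156644). -/
theorem blowupProfile_of_crux :
    QuantisedSymmetry.PolyhedralDssProfileExists → Blowup.BlowupTypeIDssProfile :=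
  Theorems.PolyhedralDssProfileExists.PolyhedralCell.stub_dominatesBlowupProfile

/-- **W₃** (DSS without the sector): a nontrivial Type-I `c`-DSS ancient mild profile for some `c > 1`
(the plain half of W₂).  crux → W₃ → W₂. -/
def DssProfileExists : Prop :=
  ∃ c : ℝ, 1 < c ∧ ∃ u : ℝ → ℝ³ → ℝ³, IsAncientMildSolution 1 u ∧
    (∀ t < 0, AEStronglyMeasurable (u t) volume) ∧ IsDiscretelySelfSimilar c u ∧
    (∃ C₀ : ℝ, HasTypeIDecay C₀ u) ∧ ¬ (∀ t < 0, u t =ᵐ[volume] 0)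

theorem dssProfileExists_of_crux (h : QuantisedSymmetry.PolyhedralDssProfileExists) :
    DssProfileExists := by
  obtain ⟨G, -, -, -, c, hc, u, hanc, hmeas, hdss, hdec, -, hnt⟩ := h
  exact ⟨c, hc, u, hanc, hmeas, hdss, hdec, hnt⟩

theorem blowupProfile_of_dssProfileExists (h : DssProfileExists) : Blowup.BlowupTypeIDssProfile := by
  obtain ⟨c, hc, u, hanc, hmeas, hdss, hdec, hnt⟩ := h
  dsimp only [Blowup.BlowupTypeIDssProfile]
  exact fun hL => hnt ((hL c).1 hc u hanc hmeas hdss hdec)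

theorem typeIAncientExists_of_dssProfileExists (h : DssProfileExists) : TypeIAncientExists := by
  obtain ⟨c, -, u, hanc, hmeas, -, hdec, hnt⟩ := h
  exact ⟨u, hanc, hmeas, hdec, hnt⟩

/-! ## §2 Decompositions

### D-CAP: certificate ∧ fixed-point theorem
-/

/-- **K2** (the ∀-piece of D-CAP): the Banach fixed-point theorem on a closed ball, in the
radii-polynomial form used by computer-assisted proofs (`T` = Newton-like operator `x - A F x`;
`Y` = defect bound, `Z` = contraction bound on the ball, `Y + Z r ≤ r`).  A THEOREM (proved below). -/
def RadiiPolynomialTheorem : Prop :=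
  ∀ (E : Type) [NormedAddCommGroup E] [NormedSpace ℝ E] [CompleteSpace E]
    (T : E → E) (x₀ : E) (Y Z r : ℝ), 0 ≤ r → 0 ≤ Z → Z < 1 →
    ‖T x₀ - x₀‖ ≤ Y →
    (∀ x ∈ Metric.closedBall x₀ r, ∀ y ∈ Metric.closedBall x₀ r, ‖T x - T y‖ ≤ Z * ‖x - y‖) →
    Y + Z * r ≤ r → ∃ x ∈ Metric.closedBall x₀ r, T x = x

/-- **K1** (the ∃-piece of D-CAP): a CERTIFIED CANDIDATE — a Banach space `E`, a Newton-like operator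
`T` whose fixed points in the ball are realised (by `ι`) as polyhedral cells with nontrivial `L⁴` datum,
a centre `x₀` (the numerical approximate cell) and radii data `Y, Z, r` satisfying the inequalities.
This is where the whole difficulty of the crux sits (census §Decomposition). -/
def CertifiedCandidateExists : Prop :=
  ∃ (E : Type) (_ : NormedAddCommGroup E) (_ : NormedSpace ℝ E), CompleteSpace E ∧
    ∃ (T : E → E) (x₀ : E) (Y Z r : ℝ) (G : Subgroup (ℝ³ ≃ₗᵢ[ℝ] ℝ³)) (c : ℝ)
      (ι : E → (ℝ → ℝ³ → ℝ³)),
      IsPolyhedralGroup G ∧ 1 < c ∧ 0 ≤ r ∧ 0 ≤ Z ∧ Z < 1 ∧ ‖T x₀ - x₀‖ ≤ Y ∧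
      (∀ x ∈ Metric.closedBall x₀ r, ∀ y ∈ Metric.closedBall x₀ r, ‖T x - T y‖ ≤ Z * ‖x - y‖) ∧
      Y + Z * r ≤ r ∧
      (∀ x ∈ Metric.closedBall x₀ r, T x = x →
        IsGCell G c (ι x) ∧ MemLp (ι x (-1)) 4 volume ∧ ¬ (ι x (-1) =ᵐ[volume] 0))

/-- The D-CAP assembly `K1 → K2 → CellExists` (logic only). -/
theorem cellExists_of_certificate (h₁ : CertifiedCandidateExists) (h₂ : RadiiPolynomialTheorem) :
    CellExists := by
  obtain ⟨E, i₁, i₂, i₃, T, x₀, Y, Z, r, G, c, ι, hG, hc, hr, hZ0, hZ1, hY, hLip, hrad, hreal⟩ := h₁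
  obtain ⟨x, hx, hfix⟩ := h₂ E T x₀ Y Z r hr hZ0 hZ1 hY hLip hrad
  obtain ⟨hcell, hL4, hnt⟩ := hreal x hx hfix
  exact ⟨G, hG, c, hc, ι x, hcell, hL4, hnt⟩

/-- **K2 is a theorem** (Banach fixed point on the complete closed ball; Mathlib
`ContractingWith.exists_fixedPoint'`). -/
theorem radiiPolynomialTheorem_holds : RadiiPolynomialTheorem := by
  intro E _ _ _ T x₀ Y Z r hr hZ0 hZ1 hY hLip hrad
  set s : Set E := Metric.closedBall x₀ r with hs
  have hx₀s : x₀ ∈ s := Metric.mem_closedBall_self hr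
  -- `T` maps the ball into itself
  have hmaps : MapsTo T s s := by
    intro x hx
    have hx' : ‖x - x₀‖ ≤ r := by simpa [s, dist_eq_norm] using hx
    have h1 : ‖T x - T x₀‖ ≤ Z * ‖x - x₀‖ := hLip x hx x₀ hx₀s
    have h2 : ‖T x - x₀‖ ≤ ‖T x - T x₀‖ + ‖T x₀ - x₀‖ := norm_sub_le_norm_sub_add_norm_sub _ _ _
    have h3 : Z * ‖x - x₀‖ ≤ Z * r := mul_le_mul_of_nonneg_left hx' hZ0
    have : ‖T x - x₀‖ ≤ r := by linarith
    simpa [s, dist_eq_norm] using this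
  -- `T` is a contraction on the ball
  have hK : ContractingWith ⟨Z, hZ0⟩ (hmaps.restrict T s s) := by
    refine ⟨by exact_mod_cast hZ1, ?_⟩
    refine LipschitzWith.of_dist_le_mul fun x y => ?_
    show dist (T x.1) (T y.1) ≤ Z * dist x.1 y.1
    rw [dist_eq_norm, dist_eq_norm]
    exact hLip x.1 x.2 y.1 y.2
  have hsc : IsComplete s := (Metric.isClosed_closedBall).isComplete
  obtain ⟨y, hys, hfix, -⟩ :=
    ContractingWith.exists_fixedPoint' hsc hmaps hK hx₀s (edist_ne_top _ _)
  exact ⟨y, hys, hfix⟩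

/-- Hence D-CAP collapses onto K1: `K1 → CellExists → crux` with no further hypothesis. -/
theorem crux_of_certificate (h₁ : CertifiedCandidateExists) :
    QuantisedSymmetry.PolyhedralDssProfileExists :=
  crux_of_cellExists (cellExists_of_certificate h₁ radiiPolynomialTheorem_holds)

/-!
### D-A: approximate cells ∧ compactness-with-floor
-/

/-- An `ε`-approximate `G`-cell: as `IsGCell` but the Oseen-mild identity holds only up to `ε` in sup norm
(zoom closing, weak divergence-freeness and equivariance kept exact — they are linear constraints a
Galerkin/PINN ansatz can satisfy identically). -/
def IsApproxGCell (G : Subgroup (ℝ³ ≃ₗᵢ[ℝ] ℝ³)) (c ε : ℝ) (v : ℝ → ℝ³ → ℝ³) : Prop :=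
  ContinuousOn (Function.uncurry v) (Set.Icc (-1 : ℝ) (-(c ^ 2)⁻¹) ×ˢ Set.univ) ∧
    (∀ t ∈ Set.Icc (-1 : ℝ) (-(c ^ 2)⁻¹), IsWeaklyDivFree (v t)) ∧
    (∀ s t : ℝ, -1 ≤ s → s < t → t ≤ -(c ^ 2)⁻¹ → ∀ x,
      ‖v t x - (heatFlow (v s) (t - s) x - oseenDuhamel 1 s v v t x)‖ ≤ ε) ∧
    (∀ x, v (-(c ^ 2)⁻¹) x = c • v (-1) (c • x)) ∧
    (∀ g ∈ G, ∀ t ∈ Set.Icc (-1 : ℝ) (-(c ^ 2)⁻¹), ∀ x, v t (g x) = g (v t x))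

/-- **A1** (the ∃-piece of D-A): for one polyhedral `G`, one factor `c`, uniform constants `C` (Type-I
envelope on the period), `R, δ` (a LOCAL floor at the datum), approximate cells of every accuracy exist. -/
def ApproximateCellsExist : Prop :=
  ∃ G : Subgroup (ℝ³ ≃ₗᵢ[ℝ] ℝ³), IsPolyhedralGroup G ∧ ∃ c : ℝ, 1 < c ∧ ∃ (C R δ : ℝ), 0 < δ ∧
    ∀ ε > 0, ∃ v : ℝ → ℝ³ → ℝ³, IsApproxGCell G c ε v ∧
      (∀ t ∈ Set.Icc (-1 : ℝ) (-(c ^ 2)⁻¹), ∀ x, ‖v t x‖ ≤ C / (1 + ‖x‖)) ∧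
      (∃ x ∈ Metric.closedBall (0 : ℝ³) R, δ ≤ ‖v (-1) x‖)

/-- **A2** (the ∀-piece of D-A, a parabolic-compactness THEOREM to be proved: local Hölder bounds from the
uniform envelope via the Oseen kernel, Arzelà–Ascoli on compacts, dominated convergence in the Duhamel
formula using the envelope `C/(1+|x|)`, the floor surviving locally uniform convergence, `L⁴` from the
envelope). Stated for all parameters. -/
def CompactnessWithFloor : Prop :=
  ∀ (G : Subgroup (ℝ³ ≃ₗᵢ[ℝ] ℝ³)) (c C R δ : ℝ), 1 < c → 0 < δ →
    (∀ ε > 0, ∃ v : ℝ → ℝ³ → ℝ³, IsApproxGCell G c ε v ∧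
      (∀ t ∈ Set.Icc (-1 : ℝ) (-(c ^ 2)⁻¹), ∀ x, ‖v t x‖ ≤ C / (1 + ‖x‖)) ∧
      (∃ x ∈ Metric.closedBall (0 : ℝ³) R, δ ≤ ‖v (-1) x‖)) →
    ∃ v : ℝ → ℝ³ → ℝ³, IsGCell G c v ∧ MemLp (v (-1)) 4 volume ∧ ¬ (v (-1) =ᵐ[volume] 0)

/-- The D-A assembly `A1 → A2 → CellExists` (logic only). -/
theorem cellExists_of_approx (h₁ : ApproximateCellsExist) (h₂ : CompactnessWithFloor) : CellExists := by
  obtain ⟨G, hG, c, hc, C, R, δ, hδ, happrox⟩ := h₁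
  obtain ⟨v, hcell, hL4, hnt⟩ := h₂ G c C R δ hc hδ happrox
  exact ⟨G, hG, c, hc, v, hcell, hL4, hnt⟩

/-- Conversely an exact cell is an approximate cell of every accuracy (so, modulo the envelope and the
floor which an exact nontrivial Type-I cell carries, A1 is the crux again once A2 is a theorem). -/
theorem isApproxGCell_of_isGCell {G : Subgroup (ℝ³ ≃ₗᵢ[ℝ] ℝ³)} {c : ℝ} {v : ℝ → ℝ³ → ℝ³}
    (h : IsGCell G c v) {ε : ℝ} (hε : 0 ≤ ε) : IsApproxGCell G c ε v := by
  obtain ⟨hcont, -, hdiv, hmild, hzoom, heqv⟩ := h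
  refine ⟨hcont, hdiv, ?_, hzoom, heqv⟩
  intro s t hs hst ht x
  rw [hmild s t hs hst ht x, sub_self, norm_zero]
  exact hε

/-! ## §3 Strengthenings -/

/-- **S⁺** (the rigid strengthening: a STEADY polyhedral profile, i.e. a continuously self-similar
Leray profile `U` with Type-I decay, `G`-equivariant, nonzero).  Refuted by Tsai 1998 Thm 1
(`tsai_selfsimilar`: profiles in `L^q`, `3 < q < ∞`, vanish; `C/(1+|y|) ∈ L⁴(ℝ³)`), see
`not_steadyPolyhedralProfileExists`. -/
def SteadyPolyhedralProfileExists : Prop :=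
  ∃ G : Subgroup (ℝ³ ≃ₗᵢ[ℝ] ℝ³), IsPolyhedralGroup G ∧ ∃ (a : ℝ) (U : ℝ³ → ℝ³) (P : ℝ³ → ℝ),
    0 < a ∧ IsLerayProfile 1 a U P ∧ (∃ C : ℝ, ∀ y, ‖U y‖ ≤ C / (1 + ‖y‖)) ∧
    (∀ g ∈ G, ∀ y, U (g y) = g (U y)) ∧ U ≠ 0

/-- A continuous field under the Type-I envelope `C/(1+|y|)` is in `L⁴(ℝ³)`. -/
theorem memLp_four_of_envelope {U : ℝ³ → ℝ³} (hU : Continuous U) {C : ℝ}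
    (hC : ∀ y, ‖U y‖ ≤ C / (1 + ‖y‖)) : MemLp U 4 volume := by
  have hC0 : 0 ≤ C := by
    have := hC 0
    have h1 : (0 : ℝ) ≤ C / (1 + ‖(0 : ℝ³)‖) := (norm_nonneg _).trans this
    simpa using h1
  -- domination by the integrable function `C⁴ (1+|y|)^{-4}`
  have hint : Integrable (fun y : ℝ³ => C ^ 4 * (1 + ‖y‖) ^ (-(4 : ℝ))) volume := by
    refine (integrable_one_add_norm ?_).const_mul _
    have h3 : Module.finrank ℝ ℝ³ = 3 := by simp [finrank_euclideanSpace]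
    rw [h3]
    norm_num
  have h4 : MemLp U 4 volume ↔
      Integrable (fun y => ‖U y‖ ^ (4 : ℝ≥0∞).toReal) volume :=
    (integrable_norm_rpow_iff hU.aestronglyMeasurable (by norm_num) (by norm_num)).symm
  rw [h4]
  refine hint.mono' (hU.norm.rpow_const fun _ => Or.inr ENNReal.toReal_nonneg).aestronglyMeasurable
    (Filter.Eventually.of_forall fun y => ?_)
  have hpos : 0 < 1 + ‖y‖ := by positivity
  have hle : ‖U y‖ ≤ C / (1 + ‖y‖) := hC y
  have hnn : 0 ≤ ‖U y‖ := norm_nonneg _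
  have htoReal : (4 : ℝ≥0∞).toReal = 4 := by norm_num
  rw [Real.norm_eq_abs, htoReal, abs_of_nonneg (by positivity)]
  calc ‖U y‖ ^ (4 : ℝ) = ‖U y‖ ^ (4 : ℕ) := by norm_cast
    _ ≤ (C / (1 + ‖y‖)) ^ (4 : ℕ) := pow_le_pow_left₀ hnn hle 4
    _ = C ^ 4 * (1 + ‖y‖) ^ (-(4 : ℝ)) := by
        rw [div_pow, Real.rpow_neg hpos.le, div_eq_mul_inv]
        norm_cast

/-- **S⁺ is refuted** (conditionally on the Literature fact `tsai_selfsimilar`, Tsai 1998 Thm 1): there is no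
steady polyhedral Type-I profile — the continuously-self-similar end of any continuation path is empty. -/
theorem not_steadyPolyhedralProfileExists (hT : tsai_selfsimilar) : ¬ SteadyPolyhedralProfileExists := by
  rintro ⟨G, -, a, U, P, ha, hprof, ⟨C, hC⟩, -, hne⟩
  have hL4 : MemLp U 4 volume := memLp_four_of_envelope hprof.contDiff_velocity.continuous hC
  exact hne (hT one_pos ha hprof (by norm_num) (by norm_num) hL4)

end Summit.NavierStokesRegularity.NavierStokesRegularity.Cruxes.PolyhedralDssProfileExists.StrategistS17g3

end
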